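import Literature.MathematicalPhysics.QuantumFieldTheory.Balaban1983to89.B9Eq3105AtLetters
import Literature.MathematicalPhysics.QuantumFieldTheory.Balaban1983to89.B9Thm311CubeLettersFirstThree
import Literature.MathematicalPhysics.QuantumFieldTheory.Balaban1983to89.B9Thm311PosDefViaSpectralGap
import Literature.MathematicalPhysics.QuantumFieldTheory.Balaban1983to89.Node00.OpsYCubeKnitPar
import Literature.MathematicalPhysics.QuantumFieldTheory.Balaban1983to89.B9CubeDirInverseKnitCubeLawsY

/-!
# NODE 00 (def-Y) — the BLOCK-SECTOR PROJECTION LETTERS OF THE CUBE SEQUENCE `{Ω_n(□)}` AT A GENERIC SITE PROPAGATOR, WITH THE DIRICHLET BLOCK CUT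

[B9] p. 409 l. 1–5 builds, for every cube `□` of the cover, the operators of the sequence `{Ω_n(□)}` — `Q′_□`, `Δ′_{a,□}`, the DIRICHLET
inverse `G′_□ = (Ω₀Δ′_{a,□}Ω₀)⁻¹` (p. 394), and then (3.25) `R_□ = I − G′_□Q′*_□(Q′_□G′_□²Q′*_□)⁻¹Q′_□G′_□`, `P_□ = I − R_□`, the letter
`C_□ = (Q′_□G′_□²Q′*_□)⁻¹` of (3.48) and the nonlocal part `D P_□ D*` of `Δ_{a,□}` entering (3.101)∕(3.105) — ALL OVER THE SEQUENCE's OWN BLOCKS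
`𝔅_□`, which tile `Ω₀(□)`.

In the tree the two ingredients live in different files and do not yet meet:
* r05's ✓`B9CubeLettersBondOpsL0` types `Q′_□ = QpCubeY`, `Q′*_□ = QpsCubeY` over `𝔅_□ = BlkCubeY i □` (the blocks of the torus-wide cube family
  `cubeFamY i □`), but HARD-WIRES the torus letter `G′ := GpCubeY` into `XCubeY ∕ XinvCubeY ∕ RCubeY ∕ CCubeY` (and ✓`B9Eq3105AtLetters.DPDsCubeY`);
* def-Y's ✓`Node00.OpsYCubeDirInverse.GpDirY i □ par S` is the Dirichlet `G′_□` on `S = Ω₀(□)`, zero-padded: `dirInvY (cubeProjY S) Δ′_{a,□}`, whose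
  range and co-range are the functions supported in `S`.

CAVEAT THAT FORCES THE SHAPE OF THIS FILE (junk value).  Plugging a zero-padded `G′` into a block operator `Q′G′²Q′*` over ALL blocks of the torus
and inverting with `Ring.inverse` gives `0` as soon as one block misses `S` (that block's functions are in the kernel), hence `R = id`, `P = 0`,
`DPD* = 0`: the member-block pin `DPDsY i parS (GpDirY …)` and the naive cube edition both degenerate.  Print never meets this: its `Q′_□G′_□²Q′*_□`
acts on block functions over the blocks INSIDE `Ω₀(□)` and is inverted THERE.  So the inverse below is def-Y's ring-level LOCAL INVERSE
✓`Node00.OpsYLocalInverse.dirInvY P X = P(PXP + 1 − P)⁻¹P` at the block algebra `End_ℂ(BlkCubeY i □ → 𝔸)`, `P = blkProjY 𝔖` the projection onto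
the block functions supported on a block set `𝔖 : Finset (BlkCubeY i □)` (canonically `insideBlkY i □ S`, the blocks inside `S`; the letter keeps
`𝔖` generic).  At `𝔖 = univ` it is `Ring.inverse` (✓`dirInvY_one_left`), so r05's torus letters are the special case `(Gp, 𝔖) := (GpCubeY i □ parS,
univ)` (§3, by `rfl` and one rewrite) — no law of r05's is restated.

## WHAT IS TYPED (generic complete normed `ℂ`-algebra `𝔸`; `Gp : SiteOpY 𝔸 i` ANY site propagator; `parS` ANY site transporter; `𝔖` ANY block set)

§1 the block cut: `insideBlkY i □ S`, the indicator `blkIndCubeY`, the idempotent `blkProjY i □ 𝔖` (`_apply`, `_mul_blkProjY`, `_univ`).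
§2 the letters: `XCubeGY i □ parS Gp U := Q′_□ ∘ Gp U ∘ Gp U ∘ Q′*_□`; `XinvCubeDY i □ parS Gp 𝔖 U := dirInvY (blkProjY 𝔖) (XCubeGY …)`;
   `PCubeDY := Gp U ∘ Q′*_□ ∘ XinvCubeDY ∘ Q′_□ ∘ Gp U`; `RCubeDY := id − (the same)`; `CCubeDY := XinvCubeDY ∘ diag(cWtCubeY)` ((3.48) weights, r05's);
   `DPDsCubeDY := D_U ∘ (id − RCubeDY) ∘ D*_U`; `P1CubeDY h := −[DP_□D*, h]` ((3.101)).
§3 dictionary to r05: at `(GpCubeY i □ parS, univ)` the six letters ARE `XCubeY ∕ XinvCubeY ∕ RCubeY ∕ CCubeY ∕ DPDsCubeY ∕ P1CubeY`.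
§4 algebra: `R = id − P`; `DP_□D* = D P_□ D*`; ★ (3.101) `DPDsCubeDY_comp_cutMulY` (shape of ✓`DPDsY_comp_cutMulY`) and its `*`-form; support of the
   inverse (`blkProjY ∘ Xinv = Xinv = Xinv ∘ blkProjY`); the JUNK VALUE made explicit (`XinvCubeDY_of_not_isUnit`, `RCubeDY_of_not_isUnit = id`,
   `DPDsCubeDY_of_not_isUnit = 0`); and, under the one regime hypothesis `hX : IsUnit (dirPadY (blkProjY 𝔖) (XCubeGY …))` (the compressed
   `Q′_□G′_□²Q′*_□` invertible on the block functions over `𝔖`): `Xinv ∘ X ∘ P = P = P ∘ X ∘ Xinv`, `Xinv ∘ X ∘ Xinv = Xinv`, ★ (3.20) for the sequence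
   `blkProjY 𝔖 ∘ Q′_□ ∘ Gp ∘ R_□ = 0` and `R_□ ∘ Gp ∘ Q′*_□ ∘ blkProjY 𝔖 = 0`, ★ `P_□ ∘ P_□ = P_□`, `R_□ ∘ R_□ = R_□`, `R_□ ∘ P_□ = 0 = P_□ ∘ R_□`;
   hypothesis-free `RCubeDY_apply_of_eq_zero` («R_□λ = λ when Q′_□G′_□λ vanishes on 𝔖»).
§5 symmetry (`𝔸 = M_N(ℂ)`, print's trace pairings): `blkProjY` symmetric for every block weight; `XCubeGY ∕ XinvCubeDY` symmetric for `W` and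
   `PCubeDY ∕ RCubeDY` symmetric for the site pairing whenever `Gp U` is symmetric and `Q′*_□(U)` is the `W`-adjoint of `Q′_□(U)` (no invertibility);
   instantiated at def-Y's cube letter `parKnitCubeY i □` (adjointness: r05 ✓`isAdjTr_QpCubeY_QpsCubeY_of_mem` + def-Y ✓`parKnitCubeY_mem_unitaryUnits_of_le`)
   for ANY symmetric `Gp`, and at the two letters of record `Gp := GpDirY i □ (parKnitCubeY i □) S` (Dirichlet) ∕ `GpCubeY i □ (parKnitCubeY i □)` (torus).
§6 THE LETTERS OF RECORD for the bond-side pins (one name each, so consumers cite instead of re-spelling the triple `(parKnitCubeY i □, GpDirY …, insideBlkY S)`):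
   `XDirCubeY ∕ RDirCubeY ∕ PDirCubeY ∕ CDirCubeY ∕ DPDsDirCubeY ∕ P1DirCubeY i □ S U` (abbreviations), the regime predicate `IsUnitXDirCubeY i □ S U`, and
   (3.101), idempotence, the junk value and symmetry restated at these names.

§7 THE REGIME HYPOTHESIS HOLDS AT THE LETTERS OF RECORD ([3] p. 25's argument cut to the inside blocks): `eq_zero_of_GpDirY_apply_eq_zero` (the Dirichlet
   `G′_□` is injective on `S`-supported fields once `Ω₀Δ′Ω₀ ⊕ 1` is a unit), ★★`isUnit_dirPadY_blkProjY_XCubeGY` (generic: `G′(U)` symmetric + injective on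
   `S`-fields + `Q′*_□ = (Q′_□)*_W` ⇒ the compression to `insideBlkY S` is a unit), ★★★`isUnitXDirCubeY_of_le` (at `parKnitCubeY i □`, ANY `S`, every
   `G`-valued `U`, `G ≤ U(N)`; n06-d ✓`isUnit_padDeltaCubeY_parKnitCubeY` supplies the injectivity), and the §4 identities at the letters of record freed of `hX`.

NOT HERE: degree-0 homogeneity of `R_□` in `Gp`; gauge covariance.  HONEST ACCOUNTING: letters and bookkeeping identities of (3.20)∕(3.25)∕
(3.48)∕(3.101); nothing analytic; no constant of [B9] is produced; the Yang–Mills mass gap is NOT proved here.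
[cite: Balaban1985BackgroundPropagators, (3.20)–(3.21) p.394, (3.25) p.394, (3.48) p.398, p.409 l.1–5, (3.101) p.414, (3.105) p.414]
-/

noncomputable section

namespace Literature.MathematicalPhysics.QuantumFieldTheory.Balaban1983to89.Node00.OpsYCubeProjectionG

open Node00
open B6KLevelCensusIndexV1 (KIdx)
open B6Cover236MultiLevelBlocks (cubes)
open B6Geom246MultiLevelBoxL0 (blkOf)
open B6Ineq268MultiLevelBoxL0 (W)
open B7Prop2Explicit (unitaryUnits)
open B9Thm37CubeCoverCommutators (cutMulY cutMulY_apply cutMulY_mul cutMulY_one)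
open B9Eq3104CutoffCommutators (cutCommR comp_cutMulY_eq_sub hBdY)
open B9CubeLettersOpsL0 (cubeFamY GpCubeY)
open B9CubeLettersBondOpsL0 (BlkCubeY QpCubeY QpsCubeY XCubeY XinvCubeY RCubeY CCubeY cWtCubeY)
open B9Eq3105AtLetters (DPDsCubeY P1CubeY)
open B9Thm311ReadingCoords (trIP IsSymmTr IsAdjTr)
open B9Thm311AdjointPairs (isSymmTr_sandwich_of_isAdjTr isAdjTr_reverse isSymmTr_comp_self isSymmTr_sub isSymmTr_id)
open B9Thm311PosDefViaSpectralGap (trIP_cutMulY_left)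
open B9Thm311CubeLettersFirstThree (isAdjTr_QpCubeY_QpsCubeY_of_mem)
open Node00.OpsYLocalInverse (dirPadY dirInvY mul_dirInvY dirInvY_mul dirInvY_mul_compr compr_mul_dirInvY P_mul_T_mul_dirInvY dirInvY_one_left
  dirInvY_of_not_isUnit)
open Node00.OpsYCubeDirInverse (GpDirY)
open Node00.OpsYCubeDirInverseSymm (isSymmTr_dirInvY)
open Node00.OpsYCubeKnitPar (parKnitCubeY parKnitCubeY_mem_unitaryUnits_of_le GpDirY_parKnitCubeY_isSymmTr_of_le GpCubeY_parKnitCubeY_isSymmTr_of_le)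
open scoped Matrix

variable {d ℓ : ℕ} {hd : 1 ≤ d + 1} {hL : Odd (ℓ + 1) ∧ 1 < ℓ + 1} {b₀ b₁ : ℝ}
variable {𝔸 : Type} [NormedRing 𝔸] [NormedAlgebra ℂ 𝔸] [CompleteSpace 𝔸]

/-! ## §1 The Dirichlet block cut: blocks inside `Ω₀(□)` and the projection onto their block functions -/

section BlockCut

variable (i : KIdx d ℓ hd hL b₀ b₁) (q : ↥(cubes (toKT i).D.toDomains))

open Classical in
/-- **the blocks of the cube sequence INSIDE a site set `S`** (for `S = Ω₀(□)`: the blocks `𝔅_□` of print, which tile `Ω₀(□)`): a block `s` is inside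
iff every site whose `𝔅_□`-block is `s` lies in `S`. [cite: Balaban1985BackgroundPropagators, p.408 (the sequence {Ω_n(□)} ⊂ Ω₀(□)), p.409 l.1–5, dictionary] -/
def insideBlkY (S : Finset (SiteY i)) : Finset (BlkCubeY i q) :=
  Finset.univ.filter fun s => ∀ z : SiteY i, blkOf (cubeFamY i q).toDomains z = s → z ∈ S

open Classical in
omit [NormedAlgebra ℂ 𝔸] [CompleteSpace 𝔸] in
/-- membership in `insideBlkY`, unfolded. [cite: Balaban1985BackgroundPropagators, p.409 l.1–5, bookkeeping] -/
theorem mem_insideBlkY_iff (S : Finset (SiteY i)) (s : BlkCubeY i q) :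
    s ∈ insideBlkY i q S ↔ ∀ z : SiteY i, blkOf (cubeFamY i q).toDomains z = s → z ∈ S := by
  simp [insideBlkY]

/-- the indicator of a block set. [cite: Balaban1985BackgroundPropagators, p.409 l.1–5, dictionary] -/
def blkIndCubeY (𝔖 : Finset (BlkCubeY i q)) : BlkCubeY i q → ℝ := fun s => if s ∈ 𝔖 then 1 else 0

omit [NormedAlgebra ℂ 𝔸] [CompleteSpace 𝔸] in
/-- the indicator, squared, is itself. [cite: Balaban1985BackgroundPropagators, p.409 l.1–5, bookkeeping] -/
theorem blkIndCubeY_mul_self (𝔖 : Finset (BlkCubeY i q)) (s : BlkCubeY i q) : blkIndCubeY i q 𝔖 s * blkIndCubeY i q 𝔖 s = blkIndCubeY i q 𝔖 s := by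
  unfold blkIndCubeY
  split_ifs <;> norm_num

/-- ★ **THE DIRICHLET BLOCK PROJECTION `P_𝔖`**: restriction to the block functions supported on `𝔖`, an idempotent of `End_ℂ(BlkCubeY i □ → 𝔸)`.
[cite: Balaban1985BackgroundPropagators, p.394 («G′ = (Ω₀Δ′Ω₀)⁻¹»), p.409 l.1–5, dictionary] -/
def blkProjY (𝔖 : Finset (BlkCubeY i q)) : Module.End ℂ (BlkCubeY i q → 𝔸) := cutMulY (blkIndCubeY i q 𝔖)

omit [CompleteSpace 𝔸] in
/-- the projection, evaluated. [cite: Balaban1985BackgroundPropagators, p.409 l.1–5, bookkeeping] -/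
theorem blkProjY_apply (𝔖 : Finset (BlkCubeY i q)) (ω : BlkCubeY i q → 𝔸) (s : BlkCubeY i q) :
    blkProjY (𝔸 := 𝔸) i q 𝔖 ω s = if s ∈ 𝔖 then ω s else 0 := by
  rw [blkProjY, cutMulY_apply, blkIndCubeY]
  split_ifs <;> simp

omit [CompleteSpace 𝔸] in
/-- it is idempotent. [cite: Balaban1985BackgroundPropagators, p.409 l.1–5, bookkeeping] -/
theorem blkProjY_mul_blkProjY (𝔖 : Finset (BlkCubeY i q)) : blkProjY (𝔸 := 𝔸) i q 𝔖 * blkProjY i q 𝔖 = blkProjY i q 𝔖 := by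
  rw [blkProjY, cutMulY_mul]
  exact congrArg cutMulY (funext fun s => blkIndCubeY_mul_self i q 𝔖 s)

omit [CompleteSpace 𝔸] in
/-- with every block kept the projection is the identity. [cite: Balaban1985BackgroundPropagators, p.409 l.1–5, bookkeeping] -/
theorem blkProjY_univ : blkProjY (𝔸 := 𝔸) i q Finset.univ = 1 := by
  rw [blkProjY, ← cutMulY_one]
  exact congrArg cutMulY (funext fun s => by simp [blkIndCubeY])

end BlockCut

/-! ## §2 The letters at a generic site propagator `Gp` and block cut `𝔖` -/

section Letters

variable (i : KIdx d ℓ hd hL b₀ b₁) (q : ↥(cubes (toKT i).D.toDomains))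

/-- **`(Q′_□ G′ G′ Q′*_□)(U)`** over the cube sequence's blocks, at a generic site propagator `Gp` (print: `Gp = G′_□` Dirichlet).
[cite: Balaban1985BackgroundPropagators, (3.25) p.394, p.409 l.1–5] -/
def XCubeGY (parS : SiteParY 𝔸 i) (Gp : SiteOpY 𝔸 i) (U : CfgY 𝔸 i) : (BlkCubeY i q → 𝔸) →ₗ[ℂ] (BlkCubeY i q → 𝔸) :=
  QpCubeY i q parS U ∘ₗ Gp U ∘ₗ Gp U ∘ₗ QpsCubeY i q parS U

/-- ★ **`(Q′_□G′_□²Q′*_□)⁻¹(U)` INVERTED ON THE BLOCK FUNCTIONS OVER `𝔖`** (Dirichlet block cut; `0` off the unit locus of the padded compression).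
[cite: Balaban1985BackgroundPropagators, (3.25) p.394, p.394 («(Ω₀Δ′Ω₀)⁻¹»), p.409 l.1–5] -/
def XinvCubeDY (parS : SiteParY 𝔸 i) (Gp : SiteOpY 𝔸 i) (𝔖 : Finset (BlkCubeY i q)) (U : CfgY 𝔸 i) :
    (BlkCubeY i q → 𝔸) →ₗ[ℂ] (BlkCubeY i q → 𝔸) :=
  dirInvY (blkProjY i q 𝔖) (XCubeGY i q parS Gp U)

/-- **`P_□(U) = G′_□Q′*_□(Q′_□G′_□²Q′*_□)⁻¹Q′_□G′_□`**. [cite: Balaban1985BackgroundPropagators, (3.25) p.394 (P = I − R), p.409 l.1–5, (3.105) p.414] -/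
def PCubeDY (parS : SiteParY 𝔸 i) (Gp : SiteOpY 𝔸 i) (𝔖 : Finset (BlkCubeY i q)) (U : CfgY 𝔸 i) : (SiteY i → 𝔸) →ₗ[ℂ] (SiteY i → 𝔸) :=
  Gp U ∘ₗ QpsCubeY i q parS U ∘ₗ XinvCubeDY i q parS Gp 𝔖 U ∘ₗ QpCubeY i q parS U ∘ₗ Gp U

/-- ★ **`R_□(U) = I − G′_□Q′*_□(Q′_□G′_□²Q′*_□)⁻¹Q′_□G′_□`** — (3.25) for the sequence `{Ω_n(□)}` at a generic `G′`.
[cite: Balaban1985BackgroundPropagators, (3.25) p.394, p.409 l.1–5] -/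
def RCubeDY (parS : SiteParY 𝔸 i) (Gp : SiteOpY 𝔸 i) (𝔖 : Finset (BlkCubeY i q)) (U : CfgY 𝔸 i) : (SiteY i → 𝔸) →ₗ[ℂ] (SiteY i → 𝔸) :=
  LinearMap.id - Gp U ∘ₗ QpsCubeY i q parS U ∘ₗ XinvCubeDY i q parS Gp 𝔖 U ∘ₗ QpCubeY i q parS U ∘ₗ Gp U

/-- **`C_□(U) = (Q′_□G′_□²Q′*_□)⁻¹(U)` read against the block pairing** (r05's weights `cWtCubeY`). [cite: Balaban1985BackgroundPropagators, (3.48) p.398, p.409 l.1–5] -/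
def CCubeDY (parS : SiteParY 𝔸 i) (Gp : SiteOpY 𝔸 i) (𝔖 : Finset (BlkCubeY i q)) (U : CfgY 𝔸 i) : (BlkCubeY i q → 𝔸) →ₗ[ℂ] (BlkCubeY i q → 𝔸) :=
  XinvCubeDY i q parS Gp 𝔖 U ∘ₗ liftMatY 𝔸 (Matrix.diagonal (cWtCubeY i q))

/-- ★ **`D_U P_□(U) D*_U`** — the nonlocal part of `Δ_{a,□}(U)`, the `DP_□D*` of (3.101)∕(3.105). [cite: Balaban1985BackgroundPropagators, (3.26) p.395, (3.101) p.414, (3.105) p.414] -/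
def DPDsCubeDY (parS : SiteParY 𝔸 i) (Gp : SiteOpY 𝔸 i) (𝔖 : Finset (BlkCubeY i q)) (U : CfgY 𝔸 i) : (FBondY i → 𝔸) →ₗ[ℂ] (FBondY i → 𝔸) :=
  gradY i U ∘ₗ (LinearMap.id - RCubeDY i q parS Gp 𝔖 U) ∘ₗ divY i U

/-- **`P_{□,1}(∂h)(U) := DP_□D*·h − h·DP_□D*`**. [cite: Balaban1985BackgroundPropagators, (3.101) p.414] -/
def P1CubeDY (h : SiteY i → ℝ) (parS : SiteParY 𝔸 i) (Gp : SiteOpY 𝔸 i) (𝔖 : Finset (BlkCubeY i q)) (U : CfgY 𝔸 i) :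
    (FBondY i → 𝔸) →ₗ[ℂ] (FBondY i → 𝔸) :=
  -cutCommR (hBdY i h) (hBdY i h) (DPDsCubeDY i q parS Gp 𝔖 U)

end Letters

/-! ## §3 Dictionary: at the torus letter and no cut these ARE r05's letters -/

section Dictionary

variable (i : KIdx d ℓ hd hL b₀ b₁) (q : ↥(cubes (toKT i).D.toDomains)) (parS : SiteParY 𝔸 i) (U : CfgY 𝔸 i)

/-- `X` at `G′ := GpCubeY` is r05's `XCubeY`. [cite: Balaban1985BackgroundPropagators, (3.25) p.394, bookkeeping] -/
theorem XCubeGY_GpCubeY : XCubeGY i q parS (GpCubeY i q parS) U = XCubeY i q parS U := rfl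

/-- with no cut the Dirichlet inverse is `Ring.inverse`. [cite: Balaban1985BackgroundPropagators, (3.25) p.394, bookkeeping] -/
theorem XinvCubeDY_univ (Gp : SiteOpY 𝔸 i) : XinvCubeDY i q parS Gp Finset.univ U = Ring.inverse (XCubeGY i q parS Gp U) := by
  rw [XinvCubeDY, blkProjY_univ, dirInvY_one_left]

/-- `X⁻¹` at `(GpCubeY, univ)` is r05's `XinvCubeY`. [cite: Balaban1985BackgroundPropagators, (3.25) p.394, bookkeeping] -/
theorem XinvCubeDY_GpCubeY_univ : XinvCubeDY i q parS (GpCubeY i q parS) Finset.univ U = XinvCubeY i q parS U := by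
  rw [XinvCubeDY_univ]
  rfl

/-- `R_□` at `(GpCubeY, univ)` is r05's `RCubeY`. [cite: Balaban1985BackgroundPropagators, (3.25) p.394, bookkeeping] -/
theorem RCubeDY_GpCubeY_univ : RCubeDY i q parS (GpCubeY i q parS) Finset.univ U = RCubeY i q parS U := by
  rw [RCubeDY, XinvCubeDY_GpCubeY_univ]
  rfl

/-- `P_□` at `(GpCubeY, univ)` is `id − RCubeY`. [cite: Balaban1985BackgroundPropagators, (3.25) p.394, bookkeeping] -/
theorem PCubeDY_GpCubeY_univ : PCubeDY i q parS (GpCubeY i q parS) Finset.univ U = LinearMap.id - RCubeY i q parS U := by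
  rw [← RCubeDY_GpCubeY_univ, RCubeDY, PCubeDY, sub_sub_cancel]

/-- `C_□` at `(GpCubeY, univ)` is r05's `CCubeY`. [cite: Balaban1985BackgroundPropagators, (3.48) p.398, bookkeeping] -/
theorem CCubeDY_GpCubeY_univ : CCubeDY i q parS (GpCubeY i q parS) Finset.univ U = CCubeY i q parS U := by
  rw [CCubeDY, XinvCubeDY_GpCubeY_univ]
  rfl

/-- `DP_□D*` at `(GpCubeY, univ)` is ✓`B9Eq3105AtLetters.DPDsCubeY`. [cite: Balaban1985BackgroundPropagators, (3.105) p.414, bookkeeping] -/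
theorem DPDsCubeDY_GpCubeY_univ : DPDsCubeDY i q parS (GpCubeY i q parS) Finset.univ U = DPDsCubeY i q parS U := by
  rw [DPDsCubeDY, RCubeDY_GpCubeY_univ]
  rfl

/-- `P_{□,1}(∂h)` at `(GpCubeY, univ)` is ✓`B9Eq3105AtLetters.P1CubeY`. [cite: Balaban1985BackgroundPropagators, (3.101) p.414, bookkeeping] -/
theorem P1CubeDY_GpCubeY_univ (h : SiteY i → ℝ) : P1CubeDY i q h parS (GpCubeY i q parS) Finset.univ U = P1CubeY i q h parS U := by
  rw [P1CubeDY, DPDsCubeDY_GpCubeY_univ]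
  rfl

end Dictionary

/-! ## §4 Algebra: `R = I − P`, (3.101), the support of the inverse, the junk value, and the projection identities under `hX` -/

section Algebra

variable (i : KIdx d ℓ hd hL b₀ b₁) (q : ↥(cubes (toKT i).D.toDomains)) (parS : SiteParY 𝔸 i) (Gp : SiteOpY 𝔸 i) (𝔖 : Finset (BlkCubeY i q))
  (U : CfgY 𝔸 i)

/-- `R_□ = I − P_□`. [cite: Balaban1985BackgroundPropagators, (3.25) p.394] -/
theorem RCubeDY_eq : RCubeDY i q parS Gp 𝔖 U = LinearMap.id - PCubeDY i q parS Gp 𝔖 U := rfl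

/-- `I − R_□ = P_□`. [cite: Balaban1985BackgroundPropagators, (3.25) p.394] -/
theorem id_sub_RCubeDY : LinearMap.id - RCubeDY i q parS Gp 𝔖 U = PCubeDY i q parS Gp 𝔖 U := sub_sub_cancel _ _

/-- `DP_□D* = D_U P_□(U) D*_U`. [cite: Balaban1985BackgroundPropagators, (3.105) p.414] -/
theorem DPDsCubeDY_eq_gradY_PCubeDY_divY : DPDsCubeDY i q parS Gp 𝔖 U = gradY i U ∘ₗ PCubeDY i q parS Gp 𝔖 U ∘ₗ divY i U := by
  rw [DPDsCubeDY, id_sub_RCubeDY]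

/-- ★ **(3.101) for `P_□`** as an operator identity: `DP_□D* ∘ (h·) = (h·) ∘ DP_□D* + P_{□,1}(∂h)` (the shape of ✓`DPDsY_comp_cutMulY`).
[cite: Balaban1985BackgroundPropagators, (3.101) p.414] -/
theorem DPDsCubeDY_comp_cutMulY (h : SiteY i → ℝ) :
    DPDsCubeDY i q parS Gp 𝔖 U ∘ₗ cutMulY (hBdY i h) = cutMulY (hBdY i h) ∘ₗ DPDsCubeDY i q parS Gp 𝔖 U + P1CubeDY i q h parS Gp 𝔖 U := by
  rw [P1CubeDY, comp_cutMulY_eq_sub (hBdY i h) (hBdY i h), sub_eq_add_neg]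

/-- (3.101) for `P_□` in `*`-currency (the shape of ✓`DPDsCubeY_mul_cutMulY`). [cite: Balaban1985BackgroundPropagators, (3.101) p.414] -/
theorem DPDsCubeDY_mul_cutMulY (h : SiteY i → ℝ) :
    DPDsCubeDY i q parS Gp 𝔖 U * cutMulY (hBdY i h) = cutMulY (hBdY i h) * DPDsCubeDY i q parS Gp 𝔖 U + P1CubeDY i q h parS Gp 𝔖 U := by
  rw [P1CubeDY, ← sub_eq_add_neg]
  exact comp_cutMulY_eq_sub (hBdY i h) (hBdY i h) (DPDsCubeDY i q parS Gp 𝔖 U)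

/-- support on the left: `P_𝔖 ∘ X⁻¹ = X⁻¹`. [cite: Balaban1985BackgroundPropagators, (3.25) p.394, p.409, bookkeeping] -/
theorem blkProjY_comp_XinvCubeDY : blkProjY i q 𝔖 ∘ₗ XinvCubeDY i q parS Gp 𝔖 U = XinvCubeDY i q parS Gp 𝔖 U :=
  mul_dirInvY (blkProjY_mul_blkProjY i q 𝔖) _

/-- support on the right: `X⁻¹ ∘ P_𝔖 = X⁻¹`. [cite: Balaban1985BackgroundPropagators, (3.25) p.394, p.409, bookkeeping] -/
theorem XinvCubeDY_comp_blkProjY : XinvCubeDY i q parS Gp 𝔖 U ∘ₗ blkProjY i q 𝔖 = XinvCubeDY i q parS Gp 𝔖 U :=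
  dirInvY_mul (blkProjY_mul_blkProjY i q 𝔖) _

/-- THE JUNK VALUE, explicit: off the unit locus of the padded compression, `X⁻¹ = 0` … [cite: Balaban1985BackgroundPropagators, (3.25) p.394, bookkeeping] -/
theorem XinvCubeDY_of_not_isUnit (h : ¬ IsUnit (dirPadY (blkProjY i q 𝔖) (XCubeGY i q parS Gp U))) : XinvCubeDY i q parS Gp 𝔖 U = 0 :=
  dirInvY_of_not_isUnit h

/-- … `R_□ = I` … [cite: Balaban1985BackgroundPropagators, (3.25) p.394, bookkeeping] -/
theorem RCubeDY_of_not_isUnit (h : ¬ IsUnit (dirPadY (blkProjY i q 𝔖) (XCubeGY i q parS Gp U))) : RCubeDY i q parS Gp 𝔖 U = LinearMap.id := by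
  rw [RCubeDY, XinvCubeDY_of_not_isUnit i q parS Gp 𝔖 U h, LinearMap.zero_comp, LinearMap.comp_zero, LinearMap.comp_zero, sub_zero]

/-- … and `DP_□D* = 0` (so a degenerate pin silently drops the projection part of `Δ_{a,□}`). [cite: Balaban1985BackgroundPropagators, (3.105) p.414, bookkeeping] -/
theorem DPDsCubeDY_of_not_isUnit (h : ¬ IsUnit (dirPadY (blkProjY i q 𝔖) (XCubeGY i q parS Gp U))) : DPDsCubeDY i q parS Gp 𝔖 U = 0 := by
  rw [DPDsCubeDY, RCubeDY_of_not_isUnit i q parS Gp 𝔖 U h, sub_self, LinearMap.zero_comp, LinearMap.comp_zero]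

/-- hypothesis-free: `R_□(U)λ = λ` whenever `Q′_□G′λ` vanishes on the blocks of `𝔖`. [cite: Balaban1985BackgroundPropagators, (3.20) p.394, (3.25) p.394] -/
theorem RCubeDY_apply_of_eq_zero {lam : SiteY i → 𝔸} (h : blkProjY i q 𝔖 (QpCubeY i q parS U (Gp U lam)) = 0) :
    RCubeDY i q parS Gp 𝔖 U lam = lam := by
  have hXi : XinvCubeDY i q parS Gp 𝔖 U (QpCubeY i q parS U (Gp U lam)) = 0 := by
    rw [← XinvCubeDY_comp_blkProjY, LinearMap.comp_apply, h, map_zero]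
  rw [RCubeDY, LinearMap.sub_apply, LinearMap.id_apply, LinearMap.comp_apply, LinearMap.comp_apply, LinearMap.comp_apply, LinearMap.comp_apply, hXi,
    map_zero, map_zero, sub_zero]

variable {parS Gp 𝔖 U}

/-- under the regime hypothesis, in `*`-currency: `X⁻¹ · X · P_𝔖 = P_𝔖`. [cite: Balaban1985BackgroundPropagators, (3.25) p.394, p.409, bookkeeping] -/
theorem XinvCubeDY_mul_XCubeGY_mul_blkProjY (hX : IsUnit (dirPadY (blkProjY i q 𝔖) (XCubeGY i q parS Gp U))) :
    XinvCubeDY i q parS Gp 𝔖 U * XCubeGY i q parS Gp U * blkProjY i q 𝔖 = blkProjY i q 𝔖 := by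
  have hP := blkProjY_mul_blkProjY (𝔸 := 𝔸) i q 𝔖
  calc XinvCubeDY i q parS Gp 𝔖 U * XCubeGY i q parS Gp U * blkProjY i q 𝔖
      = XinvCubeDY i q parS Gp 𝔖 U * blkProjY i q 𝔖 * XCubeGY i q parS Gp U * blkProjY i q 𝔖 := by rw [XinvCubeDY, dirInvY_mul hP]
    _ = XinvCubeDY i q parS Gp 𝔖 U * (blkProjY i q 𝔖 * XCubeGY i q parS Gp U * blkProjY i q 𝔖) := by simp only [mul_assoc]
    _ = blkProjY i q 𝔖 := dirInvY_mul_compr hP hX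

/-- ★ under the regime hypothesis: `X⁻¹ ∘ X ∘ P_𝔖 = P_𝔖` (left inverse on the block functions over `𝔖`). [cite: Balaban1985BackgroundPropagators, (3.25) p.394, p.409] -/
theorem XinvCubeDY_comp_XCubeGY_comp_blkProjY (hX : IsUnit (dirPadY (blkProjY i q 𝔖) (XCubeGY i q parS Gp U))) :
    XinvCubeDY i q parS Gp 𝔖 U ∘ₗ XCubeGY i q parS Gp U ∘ₗ blkProjY i q 𝔖 = blkProjY i q 𝔖 := by
  simpa only [Module.End.mul_eq_comp, LinearMap.comp_assoc] using XinvCubeDY_mul_XCubeGY_mul_blkProjY i q hX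

/-- in `*`-currency: `P_𝔖 · X · X⁻¹ = P_𝔖`. [cite: Balaban1985BackgroundPropagators, (3.25) p.394, p.409, bookkeeping] -/
theorem blkProjY_mul_XCubeGY_mul_XinvCubeDY (hX : IsUnit (dirPadY (blkProjY i q 𝔖) (XCubeGY i q parS Gp U))) :
    blkProjY i q 𝔖 * XCubeGY i q parS Gp U * XinvCubeDY i q parS Gp 𝔖 U = blkProjY i q 𝔖 :=
  P_mul_T_mul_dirInvY (blkProjY_mul_blkProjY (𝔸 := 𝔸) i q 𝔖) hX

/-- ★ `P_𝔖 ∘ X ∘ X⁻¹ = P_𝔖` (right inverse on the block functions over `𝔖`). [cite: Balaban1985BackgroundPropagators, (3.25) p.394, p.409] -/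
theorem blkProjY_comp_XCubeGY_comp_XinvCubeDY (hX : IsUnit (dirPadY (blkProjY i q 𝔖) (XCubeGY i q parS Gp U))) :
    blkProjY i q 𝔖 ∘ₗ XCubeGY i q parS Gp U ∘ₗ XinvCubeDY i q parS Gp 𝔖 U = blkProjY i q 𝔖 := by
  simpa only [Module.End.mul_eq_comp, LinearMap.comp_assoc] using blkProjY_mul_XCubeGY_mul_XinvCubeDY i q hX

/-- in `*`-currency: `X⁻¹ · X · X⁻¹ = X⁻¹` (a generalized inverse). [cite: Balaban1985BackgroundPropagators, (3.25) p.394, bookkeeping] -/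
theorem XinvCubeDY_mul_XCubeGY_mul_XinvCubeDY (hX : IsUnit (dirPadY (blkProjY i q 𝔖) (XCubeGY i q parS Gp U))) :
    XinvCubeDY i q parS Gp 𝔖 U * XCubeGY i q parS Gp U * XinvCubeDY i q parS Gp 𝔖 U = XinvCubeDY i q parS Gp 𝔖 U := by
  have h2 : blkProjY i q 𝔖 * XinvCubeDY i q parS Gp 𝔖 U = XinvCubeDY i q parS Gp 𝔖 U := mul_dirInvY (blkProjY_mul_blkProjY (𝔸 := 𝔸) i q 𝔖) _
  calc XinvCubeDY i q parS Gp 𝔖 U * XCubeGY i q parS Gp U * XinvCubeDY i q parS Gp 𝔖 U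
      = XinvCubeDY i q parS Gp 𝔖 U * XCubeGY i q parS Gp U * (blkProjY i q 𝔖 * XinvCubeDY i q parS Gp 𝔖 U) := by rw [h2]
    _ = XinvCubeDY i q parS Gp 𝔖 U * XCubeGY i q parS Gp U * blkProjY i q 𝔖 * XinvCubeDY i q parS Gp 𝔖 U := by simp only [mul_assoc]
    _ = blkProjY i q 𝔖 * XinvCubeDY i q parS Gp 𝔖 U := by rw [XinvCubeDY_mul_XCubeGY_mul_blkProjY i q hX]
    _ = XinvCubeDY i q parS Gp 𝔖 U := h2

/-- `X⁻¹ ∘ X ∘ X⁻¹ = X⁻¹`. [cite: Balaban1985BackgroundPropagators, (3.25) p.394, bookkeeping] -/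
theorem XinvCubeDY_comp_XCubeGY_comp_XinvCubeDY (hX : IsUnit (dirPadY (blkProjY i q 𝔖) (XCubeGY i q parS Gp U))) :
    XinvCubeDY i q parS Gp 𝔖 U ∘ₗ XCubeGY i q parS Gp U ∘ₗ XinvCubeDY i q parS Gp 𝔖 U = XinvCubeDY i q parS Gp 𝔖 U := by
  simpa only [Module.End.mul_eq_comp, LinearMap.comp_assoc] using XinvCubeDY_mul_XCubeGY_mul_XinvCubeDY i q hX

/-- ★★ **(3.20) FOR THE SEQUENCE, first half: `P_𝔖 ∘ Q′_□ ∘ G′ ∘ R_□ = 0`** — on the blocks inside `Ω₀(□)` the range of `R_□(U)` is `{λ : Q′_□G′λ = 0}`.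
[cite: Balaban1985BackgroundPropagators, (3.20)–(3.21) p.394, (3.25) p.394, p.409] -/
theorem blkProjY_QpCubeY_Gp_comp_RCubeDY (hX : IsUnit (dirPadY (blkProjY i q 𝔖) (XCubeGY i q parS Gp U))) :
    blkProjY i q 𝔖 ∘ₗ QpCubeY i q parS U ∘ₗ Gp U ∘ₗ RCubeDY i q parS Gp 𝔖 U = 0 := by
  have hkey : blkProjY i q 𝔖 ∘ₗ QpCubeY i q parS U ∘ₗ Gp U ∘ₗ Gp U ∘ₗ QpsCubeY i q parS U ∘ₗ XinvCubeDY i q parS Gp 𝔖 U = blkProjY i q 𝔖 := by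
    simpa only [XCubeGY, LinearMap.comp_assoc] using blkProjY_comp_XCubeGY_comp_XinvCubeDY i q hX
  rw [RCubeDY, LinearMap.comp_sub, LinearMap.comp_sub, LinearMap.comp_sub, LinearMap.comp_id]
  have h2 : blkProjY i q 𝔖 ∘ₗ QpCubeY i q parS U ∘ₗ Gp U ∘ₗ
      (Gp U ∘ₗ QpsCubeY i q parS U ∘ₗ XinvCubeDY i q parS Gp 𝔖 U ∘ₗ QpCubeY i q parS U ∘ₗ Gp U) =
      blkProjY i q 𝔖 ∘ₗ QpCubeY i q parS U ∘ₗ Gp U := by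
    have h := congrArg (fun T => T ∘ₗ (QpCubeY i q parS U ∘ₗ Gp U)) hkey
    simpa only [LinearMap.comp_assoc] using h
  rw [h2, sub_self]

/-- ★★ **second half: `R_□ ∘ G′ ∘ Q′*_□ ∘ P_𝔖 = 0`** — `R_□(U)` kills `G′Q′*_□ω` for every block function `ω` over `𝔖`.
[cite: Balaban1985BackgroundPropagators, (3.20)–(3.21) p.394, (3.25) p.394, p.409] -/
theorem RCubeDY_comp_Gp_QpsCubeY_blkProjY (hX : IsUnit (dirPadY (blkProjY i q 𝔖) (XCubeGY i q parS Gp U))) :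
    RCubeDY i q parS Gp 𝔖 U ∘ₗ Gp U ∘ₗ QpsCubeY i q parS U ∘ₗ blkProjY i q 𝔖 = 0 := by
  have hkey : XinvCubeDY i q parS Gp 𝔖 U ∘ₗ QpCubeY i q parS U ∘ₗ Gp U ∘ₗ Gp U ∘ₗ QpsCubeY i q parS U ∘ₗ blkProjY i q 𝔖 = blkProjY i q 𝔖 := by
    simpa only [XCubeGY, LinearMap.comp_assoc] using XinvCubeDY_comp_XCubeGY_comp_blkProjY i q hX
  have h2 : (Gp U ∘ₗ QpsCubeY i q parS U ∘ₗ XinvCubeDY i q parS Gp 𝔖 U ∘ₗ QpCubeY i q parS U ∘ₗ Gp U) ∘ₗ Gp U ∘ₗ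
      QpsCubeY i q parS U ∘ₗ blkProjY i q 𝔖 = Gp U ∘ₗ QpsCubeY i q parS U ∘ₗ blkProjY i q 𝔖 := by
    have h := congrArg (fun T => Gp U ∘ₗ QpsCubeY i q parS U ∘ₗ T) hkey
    simpa only [LinearMap.comp_assoc] using h
  rw [RCubeDY, LinearMap.sub_comp, LinearMap.id_comp, h2, sub_self]

/-- ★★ **`P_□(U)` IS AN IDEMPOTENT** under the regime hypothesis. [cite: Balaban1985BackgroundPropagators, (3.20) p.394 («orthogonal projection»), (3.25) p.394, p.409] -/
theorem PCubeDY_comp_PCubeDY (hX : IsUnit (dirPadY (blkProjY i q 𝔖) (XCubeGY i q parS Gp U))) :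
    PCubeDY i q parS Gp 𝔖 U ∘ₗ PCubeDY i q parS Gp 𝔖 U = PCubeDY i q parS Gp 𝔖 U := by
  have hkey : XinvCubeDY i q parS Gp 𝔖 U ∘ₗ QpCubeY i q parS U ∘ₗ Gp U ∘ₗ Gp U ∘ₗ QpsCubeY i q parS U ∘ₗ XinvCubeDY i q parS Gp 𝔖 U =
      XinvCubeDY i q parS Gp 𝔖 U := by
    simpa only [XCubeGY, LinearMap.comp_assoc] using XinvCubeDY_comp_XCubeGY_comp_XinvCubeDY i q hX
  have h := congrArg (fun T => Gp U ∘ₗ QpsCubeY i q parS U ∘ₗ T ∘ₗ QpCubeY i q parS U ∘ₗ Gp U) hkey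
  simpa only [PCubeDY, LinearMap.comp_assoc] using h

/-- ★★ **`R_□(U)` IS AN IDEMPOTENT** under the regime hypothesis. [cite: Balaban1985BackgroundPropagators, (3.20) p.394, (3.25) p.394, p.409, Thm 3.11 p.416 («also for P and R»)] -/
theorem RCubeDY_comp_RCubeDY (hX : IsUnit (dirPadY (blkProjY i q 𝔖) (XCubeGY i q parS Gp U))) :
    RCubeDY i q parS Gp 𝔖 U ∘ₗ RCubeDY i q parS Gp 𝔖 U = RCubeDY i q parS Gp 𝔖 U := by
  rw [RCubeDY_eq, LinearMap.sub_comp, LinearMap.id_comp, LinearMap.comp_sub, LinearMap.comp_id, PCubeDY_comp_PCubeDY i q hX, sub_self, sub_zero]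

/-- `R_□ ∘ P_□ = 0`. [cite: Balaban1985BackgroundPropagators, (3.25) p.394, bookkeeping] -/
theorem RCubeDY_comp_PCubeDY (hX : IsUnit (dirPadY (blkProjY i q 𝔖) (XCubeGY i q parS Gp U))) :
    RCubeDY i q parS Gp 𝔖 U ∘ₗ PCubeDY i q parS Gp 𝔖 U = 0 := by
  rw [RCubeDY_eq, LinearMap.sub_comp, LinearMap.id_comp, PCubeDY_comp_PCubeDY i q hX, sub_self]

/-- `P_□ ∘ R_□ = 0`. [cite: Balaban1985BackgroundPropagators, (3.25) p.394, bookkeeping] -/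
theorem PCubeDY_comp_RCubeDY (hX : IsUnit (dirPadY (blkProjY i q 𝔖) (XCubeGY i q parS Gp U))) :
    PCubeDY i q parS Gp 𝔖 U ∘ₗ RCubeDY i q parS Gp 𝔖 U = 0 := by
  rw [RCubeDY_eq, LinearMap.comp_sub, LinearMap.comp_id, PCubeDY_comp_PCubeDY i q hX, sub_self]

end Algebra

/-! ## §5 Symmetry for print's trace pairings (`𝔸 = M_N(ℂ)`) -/

section Symm

open scoped Matrix.Norms.L2Operator

variable {N : ℕ} (i : KIdx d ℓ hd hL b₀ b₁) (q : ↥(cubes (toKT i).D.toDomains)) {G : Subgroup (Matrix (Fin N) (Fin N) ℂ)ˣ}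

/-- the block projection is symmetric for every block weight. [cite: Balaban1985BackgroundPropagators, p.393 (scalar products), bookkeeping] -/
theorem blkProjY_isSymmTr (w : BlkCubeY i q → ℝ) (𝔖 : Finset (BlkCubeY i q)) : IsSymmTr w (blkProjY (𝔸 := Matrix (Fin N) (Fin N) ℂ) i q 𝔖) :=
  fun Φ Ψ => trIP_cutMulY_left w _ Φ Ψ

/-- `Q′_□G′G′Q′*_□(U)` is `W`-symmetric when `G′(U)` is symmetric and `Q′*_□(U)` is the `W`-adjoint of `Q′_□(U)` (r05's ✓`XCubeY_isSymmTr` at a generic `G′`).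
[cite: Balaban1985BackgroundPropagators, (3.20)–(3.21) p.394, (3.25) p.394, p.409] -/
theorem XCubeGY_isSymmTr (parS : SiteParY (Matrix (Fin N) (Fin N) ℂ) i) (Gp : SiteOpY (Matrix (Fin N) (Fin N) ℂ) i) (U : CfgY (Matrix (Fin N) (Fin N) ℂ) i)
    (hGp : IsSymmTr (fun _ => (1 : ℝ)) (Gp U))
    (hadj : IsAdjTr (fun _ => (1 : ℝ)) (W (cubeFamY i q).toDomains) (QpCubeY i q parS U) (QpsCubeY i q parS U)) :
    IsSymmTr (W (cubeFamY i q).toDomains) (XCubeGY i q parS Gp U) := by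
  have h := isSymmTr_sandwich_of_isAdjTr (isAdjTr_reverse hadj) (isSymmTr_comp_self hGp)
  rw [XCubeGY]
  simpa only [LinearMap.comp_assoc] using h

/-- ★ the Dirichlet-cut inverse `(Q′_□G′_□²Q′*_□)⁻¹_𝔖(U)` is `W`-symmetric (def-Y ✓`isSymmTr_dirInvY`; no invertibility needed).
[cite: Balaban1985BackgroundPropagators, (3.25) p.394, p.409, Thm 3.11 p.416] -/
theorem XinvCubeDY_isSymmTr (parS : SiteParY (Matrix (Fin N) (Fin N) ℂ) i) (Gp : SiteOpY (Matrix (Fin N) (Fin N) ℂ) i) (𝔖 : Finset (BlkCubeY i q))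
    (U : CfgY (Matrix (Fin N) (Fin N) ℂ) i) (hGp : IsSymmTr (fun _ => (1 : ℝ)) (Gp U))
    (hadj : IsAdjTr (fun _ => (1 : ℝ)) (W (cubeFamY i q).toDomains) (QpCubeY i q parS U) (QpsCubeY i q parS U)) :
    IsSymmTr (W (cubeFamY i q).toDomains) (XinvCubeDY i q parS Gp 𝔖 U) :=
  isSymmTr_dirInvY (blkProjY_isSymmTr i q _ 𝔖) (XCubeGY_isSymmTr i q parS Gp U hGp hadj)

/-- ★ `P_□(U)` is symmetric for the site pairing. [cite: Balaban1985BackgroundPropagators, (3.20)–(3.21) p.394, (3.25) p.394, p.409] -/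
theorem PCubeDY_isSymmTr (parS : SiteParY (Matrix (Fin N) (Fin N) ℂ) i) (Gp : SiteOpY (Matrix (Fin N) (Fin N) ℂ) i) (𝔖 : Finset (BlkCubeY i q))
    (U : CfgY (Matrix (Fin N) (Fin N) ℂ) i) (hGp : IsSymmTr (fun _ => (1 : ℝ)) (Gp U))
    (hadj : IsAdjTr (fun _ => (1 : ℝ)) (W (cubeFamY i q).toDomains) (QpCubeY i q parS U) (QpsCubeY i q parS U)) :
    IsSymmTr (fun _ => (1 : ℝ)) (PCubeDY i q parS Gp 𝔖 U) := by
  have hS : IsSymmTr (fun _ => (1 : ℝ)) (QpsCubeY i q parS U ∘ₗ XinvCubeDY i q parS Gp 𝔖 U ∘ₗ QpCubeY i q parS U) :=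
    isSymmTr_sandwich_of_isAdjTr hadj (XinvCubeDY_isSymmTr i q parS Gp 𝔖 U hGp hadj)
  have hT : IsSymmTr (fun _ => (1 : ℝ)) (Gp U ∘ₗ (QpsCubeY i q parS U ∘ₗ XinvCubeDY i q parS Gp 𝔖 U ∘ₗ QpCubeY i q parS U) ∘ₗ Gp U) :=
    isSymmTr_sandwich_of_isAdjTr (Q := Gp U) (Qs := Gp U) hGp hS
  rw [PCubeDY]
  simpa only [LinearMap.comp_assoc] using hT

/-- ★★ **`R_□(U)` IS SYMMETRIC** for the site pairing whenever `G′(U)` is symmetric and `Q′*_□(U)` is the `W`-adjoint of `Q′_□(U)` (r05's ✓`RCubeY_isSymmTr`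
at a generic `G′` and block cut). [cite: Balaban1985BackgroundPropagators, (3.20)–(3.21) p.394, (3.25) p.394, p.409, Thm 3.11 p.416 («also for P and R»)] -/
theorem RCubeDY_isSymmTr (parS : SiteParY (Matrix (Fin N) (Fin N) ℂ) i) (Gp : SiteOpY (Matrix (Fin N) (Fin N) ℂ) i) (𝔖 : Finset (BlkCubeY i q))
    (U : CfgY (Matrix (Fin N) (Fin N) ℂ) i) (hGp : IsSymmTr (fun _ => (1 : ℝ)) (Gp U))
    (hadj : IsAdjTr (fun _ => (1 : ℝ)) (W (cubeFamY i q).toDomains) (QpCubeY i q parS U) (QpsCubeY i q parS U)) :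
    IsSymmTr (fun _ => (1 : ℝ)) (RCubeDY i q parS Gp 𝔖 U) := by
  rw [RCubeDY_eq]
  exact isSymmTr_sub (isSymmTr_id _) (PCubeDY_isSymmTr i q parS Gp 𝔖 U hGp hadj)

/-- ★★ **AT def-Y's CUBE LETTER `parKnitCubeY i □`**, for a `G`-valued configuration, `G ≤ U(N)`, and ANY symmetric site propagator `Gp`: `R_□(U)` is symmetric
(adjointness of `Q′_□ ∕ Q′*_□` by r05 ✓`isAdjTr_QpCubeY_QpsCubeY_of_mem` fed with def-Y ✓`parKnitCubeY_mem_unitaryUnits_of_le`).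
[cite: Balaban1985BackgroundPropagators, (3.19) p.393, (3.20)–(3.21) p.394, (3.25) p.394, p.409] -/
theorem RCubeDY_parKnitCubeY_isSymmTr_of_le (hGU : G ≤ unitaryUnits (Matrix (Fin N) (Fin N) ℂ)) {Gp : SiteOpY (Matrix (Fin N) (Fin N) ℂ) i}
    {U : CfgY (Matrix (Fin N) (Fin N) ℂ) i} (hU : ∀ μ x, U μ x ∈ G) (hGp : IsSymmTr (fun _ => (1 : ℝ)) (Gp U)) (𝔖 : Finset (BlkCubeY i q)) :
    IsSymmTr (fun _ => (1 : ℝ)) (RCubeDY i q (parKnitCubeY i q) Gp 𝔖 U) :=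
  RCubeDY_isSymmTr i q (parKnitCubeY i q) Gp 𝔖 U hGp
    (isAdjTr_QpCubeY_QpsCubeY_of_mem i q le_rfl (parKnitCubeY i q) U fun z z' => parKnitCubeY_mem_unitaryUnits_of_le i q hGU hU z z')

/-- ★★ **AT THE DIRICHLET LETTER OF RECORD** `G′_□ = GpDirY i □ (parKnitCubeY i □) S`: `R_{□,Ω₀}(U)` is symmetric at every `G`-valued `U`, `G ≤ U(N)`.
[cite: Balaban1985BackgroundPropagators, p.394 («G′ = (Ω₀Δ′Ω₀)⁻¹»), (3.25) p.394, p.409 l.1–5, Thm 3.11 p.416] -/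
theorem RCubeDY_parKnitCubeY_GpDirY_isSymmTr_of_le (hGU : G ≤ unitaryUnits (Matrix (Fin N) (Fin N) ℂ)) (S : Finset (SiteY i)) (𝔖 : Finset (BlkCubeY i q))
    {U : CfgY (Matrix (Fin N) (Fin N) ℂ) i} (hU : ∀ μ x, U μ x ∈ G) :
    IsSymmTr (fun _ => (1 : ℝ)) (RCubeDY i q (parKnitCubeY i q) (GpDirY i q (parKnitCubeY i q) S) 𝔖 U) :=
  RCubeDY_parKnitCubeY_isSymmTr_of_le i q hGU hU (GpDirY_parKnitCubeY_isSymmTr_of_le i q hGU S hU) 𝔖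

/-- ★ **AT THE TORUS LETTER** `G′ = GpCubeY i □ (parKnitCubeY i □)`: `R_□(U)` is symmetric at every `G`-valued `U`, `G ≤ U(N)` (at `𝔖 = univ` this is
r05's `RCubeY i □ (parKnitCubeY i □) U`, §3). [cite: Balaban1985BackgroundPropagators, (3.25) p.394, p.409, Thm 3.11 p.416] -/
theorem RCubeDY_parKnitCubeY_GpCubeY_isSymmTr_of_le (hGU : G ≤ unitaryUnits (Matrix (Fin N) (Fin N) ℂ)) (𝔖 : Finset (BlkCubeY i q))
    {U : CfgY (Matrix (Fin N) (Fin N) ℂ) i} (hU : ∀ μ x, U μ x ∈ G) :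
    IsSymmTr (fun _ => (1 : ℝ)) (RCubeDY i q (parKnitCubeY i q) (GpCubeY i q (parKnitCubeY i q)) 𝔖 U) :=
  RCubeDY_parKnitCubeY_isSymmTr_of_le i q hGU hU (GpCubeY_parKnitCubeY_isSymmTr_of_le i q hGU hU) 𝔖

end Symm

/-! ## §6 The letters OF RECORD for the sequence `{Ω_n(□)}`: cube transporter `parKnitCubeY i □` ((β)), Dirichlet `G′_□` on `S = Ω₀(□)`, cut `insideBlkY S` -/

section OfRecord

variable (i : KIdx d ℓ hd hL b₀ b₁) (q : ↥(cubes (toKT i).D.toDomains))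

/-- **`(Q′_□G′_□²Q′*_□)(U)` of record** (`G′_□ = GpDirY i □ (parKnitCubeY i □) S`). [cite: Balaban1985BackgroundPropagators, (3.25) p.394, p.409 l.1–5] -/
abbrev XDirCubeY (S : Finset (SiteY i)) (U : CfgY 𝔸 i) : (BlkCubeY i q → 𝔸) →ₗ[ℂ] (BlkCubeY i q → 𝔸) :=
  XCubeGY i q (parKnitCubeY i q) (GpDirY i q (parKnitCubeY i q) S) U

/-- **the regime hypothesis of record**: the compression of `Q′_□G′_□²Q′*_□(U)` to the block functions over the blocks inside `S` is invertible there.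
[cite: Balaban1985BackgroundPropagators, (3.25) p.394 («positive operators»), p.409 l.1–5] -/
def IsUnitXDirCubeY (S : Finset (SiteY i)) (U : CfgY 𝔸 i) : Prop :=
  IsUnit (dirPadY (blkProjY i q (insideBlkY i q S)) (XDirCubeY i q S U))

/-- ★★ **`R_□(U)` OF RECORD** — (3.25) for the sequence `{Ω_n(□)}` with the Dirichlet `G′_□` and the inverse taken on the blocks inside `Ω₀(□) = S`.
[cite: Balaban1985BackgroundPropagators, (3.25) p.394, p.409 l.1–5] -/
abbrev RDirCubeY (S : Finset (SiteY i)) (U : CfgY 𝔸 i) : (SiteY i → 𝔸) →ₗ[ℂ] (SiteY i → 𝔸) :=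
  RCubeDY i q (parKnitCubeY i q) (GpDirY i q (parKnitCubeY i q) S) (insideBlkY i q S) U

/-- **`P_□(U)` of record**. [cite: Balaban1985BackgroundPropagators, (3.25) p.394, p.409 l.1–5, (3.105) p.414] -/
abbrev PDirCubeY (S : Finset (SiteY i)) (U : CfgY 𝔸 i) : (SiteY i → 𝔸) →ₗ[ℂ] (SiteY i → 𝔸) :=
  PCubeDY i q (parKnitCubeY i q) (GpDirY i q (parKnitCubeY i q) S) (insideBlkY i q S) U

/-- **`C_□(U)` of record**. [cite: Balaban1985BackgroundPropagators, (3.48) p.398, p.409 l.1–5] -/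
abbrev CDirCubeY (S : Finset (SiteY i)) (U : CfgY 𝔸 i) : (BlkCubeY i q → 𝔸) →ₗ[ℂ] (BlkCubeY i q → 𝔸) :=
  CCubeDY i q (parKnitCubeY i q) (GpDirY i q (parKnitCubeY i q) S) (insideBlkY i q S) U

/-- ★★ **`D_U P_□(U) D*_U` OF RECORD** — the bond-side pin `Pl_□` for the local operators `Δ_{a,□} = Δ_loc − Pl_□` of (3.105).
[cite: Balaban1985BackgroundPropagators, (3.26) p.395, p.409 l.1–5, (3.105) p.414] -/
abbrev DPDsDirCubeY (S : Finset (SiteY i)) (U : CfgY 𝔸 i) : (FBondY i → 𝔸) →ₗ[ℂ] (FBondY i → 𝔸) :=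
  DPDsCubeDY i q (parKnitCubeY i q) (GpDirY i q (parKnitCubeY i q) S) (insideBlkY i q S) U

/-- **`P_{□,1}(∂h)(U)` of record**. [cite: Balaban1985BackgroundPropagators, (3.101) p.414] -/
abbrev P1DirCubeY (h : SiteY i → ℝ) (S : Finset (SiteY i)) (U : CfgY 𝔸 i) : (FBondY i → 𝔸) →ₗ[ℂ] (FBondY i → 𝔸) :=
  P1CubeDY i q h (parKnitCubeY i q) (GpDirY i q (parKnitCubeY i q) S) (insideBlkY i q S) U

/-- ★ (3.101) at the letters of record. [cite: Balaban1985BackgroundPropagators, (3.101) p.414] -/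
theorem DPDsDirCubeY_comp_cutMulY (h : SiteY i → ℝ) (S : Finset (SiteY i)) (U : CfgY 𝔸 i) :
    DPDsDirCubeY i q S U ∘ₗ cutMulY (hBdY i h) = cutMulY (hBdY i h) ∘ₗ DPDsDirCubeY i q S U + P1DirCubeY i q h S U :=
  DPDsCubeDY_comp_cutMulY i q _ _ _ U h

/-- `R_□ ∘ R_□ = R_□` at the letters of record, in the regime. [cite: Balaban1985BackgroundPropagators, (3.20) p.394, (3.25) p.394, p.409] -/
theorem RDirCubeY_comp_RDirCubeY {S : Finset (SiteY i)} {U : CfgY 𝔸 i} (hX : IsUnitXDirCubeY i q S U) :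
    RDirCubeY i q S U ∘ₗ RDirCubeY i q S U = RDirCubeY i q S U :=
  RCubeDY_comp_RCubeDY i q hX

/-- off the regime the pin of record is `0` (the junk value, explicit). [cite: Balaban1985BackgroundPropagators, (3.105) p.414, bookkeeping] -/
theorem DPDsDirCubeY_of_not (S : Finset (SiteY i)) {U : CfgY 𝔸 i} (h : ¬ IsUnitXDirCubeY i q S U) : DPDsDirCubeY i q S U = 0 :=
  DPDsCubeDY_of_not_isUnit i q _ _ _ U h

end OfRecord

section OfRecordSymm

open scoped Matrix.Norms.L2Operator

variable {N : ℕ} (i : KIdx d ℓ hd hL b₀ b₁) (q : ↥(cubes (toKT i).D.toDomains)) {G : Subgroup (Matrix (Fin N) (Fin N) ℂ)ˣ}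

/-- ★★ **`R_□(U)` OF RECORD IS SYMMETRIC** at every `G`-valued configuration, `G ≤ U(N)`. [cite: Balaban1985BackgroundPropagators, (3.25) p.394, p.409 l.1–5, Thm 3.11 p.416 («also for P and R»)] -/
theorem RDirCubeY_isSymmTr_of_le (hGU : G ≤ unitaryUnits (Matrix (Fin N) (Fin N) ℂ)) (S : Finset (SiteY i)) {U : CfgY (Matrix (Fin N) (Fin N) ℂ) i}
    (hU : ∀ μ x, U μ x ∈ G) : IsSymmTr (fun _ => (1 : ℝ)) (RDirCubeY i q S U) :=
  RCubeDY_parKnitCubeY_GpDirY_isSymmTr_of_le i q hGU S _ hU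

/-- `P_□(U)` of record is symmetric likewise. [cite: Balaban1985BackgroundPropagators, (3.25) p.394, p.409 l.1–5, Thm 3.11 p.416] -/
theorem PDirCubeY_isSymmTr_of_le (hGU : G ≤ unitaryUnits (Matrix (Fin N) (Fin N) ℂ)) (S : Finset (SiteY i)) {U : CfgY (Matrix (Fin N) (Fin N) ℂ) i}
    (hU : ∀ μ x, U μ x ∈ G) : IsSymmTr (fun _ => (1 : ℝ)) (PDirCubeY i q S U) :=
  PCubeDY_isSymmTr i q (parKnitCubeY i q) _ _ U (GpDirY_parKnitCubeY_isSymmTr_of_le i q hGU S hU)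
    (isAdjTr_QpCubeY_QpsCubeY_of_mem i q le_rfl (parKnitCubeY i q) U fun z z' => parKnitCubeY_mem_unitaryUnits_of_le i q hGU hU z z')

end OfRecordSymm

/-! ## §7 THE REGIME HYPOTHESIS HOLDS: `Ω₀`-compressed positivity ⇒ `IsUnit (dirPadY (blkProjY (insideBlkY S)) X_□)` ([3] p. 25's argument, cut to `𝔖`) -/

section Pos

open scoped Matrix.Norms.L2Operator
open B9Eq39Adjoint (R_zero)
open B9Thm311DeltaPrimePos (trIP_self_pos)
open B9Thm311ReadingCoords (isUnit_of_injective)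
open B9Thm311CubeLettersFirstThree (QpsCubeY_apply_eq qpsCubeY_injective)
open Node00.OpsYLocalInverse (cubeProjY cubeProjY_apply cubeProjY_mul_cubeProjY)
open Node00.OpsYCubeDirInverse (padDeltaCubeY)
open B9CubeLettersOpsL0 (deltaPrimeACubeY)
open B9CubeDirInverseKnitCubeLawsY (isUnit_padDeltaCubeY_parKnitCubeY)

variable (i : KIdx d ℓ hd hL b₀ b₁) (q : ↥(cubes (toKT i).D.toDomains))

/-- the Dirichlet `G′_□(U) = Ω₀(Ω₀Δ′Ω₀ ⊕ 1)⁻¹Ω₀` is INJECTIVE ON THE `Ω₀`-SUPPORTED FIELDS once the padded compression is a unit (generic `𝔸`, any transporter).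
[cite: Balaban1985BackgroundPropagators, p.394 («Its inverse is denoted by G′»), p.409 l.1–5] -/
theorem eq_zero_of_GpDirY_apply_eq_zero (par : SiteParY 𝔸 i) (S : Finset (SiteY i)) (U : CfgY 𝔸 i) (hΔ : IsUnit (padDeltaCubeY i q par S U))
    (lam : SiteY i → 𝔸) (hlam : ∀ z, z ∉ S → lam z = 0) (h0 : GpDirY i q par S U lam = 0) : lam = 0 := by
  have hP := cubeProjY_mul_cubeProjY (𝔸 := 𝔸) i S
  have hΔ' : IsUnit (dirPadY (cubeProjY i S) (deltaPrimeACubeY i q par U)) := hΔ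
  have hfix : cubeProjY i S lam = lam := funext fun z => by
    rw [cubeProjY_apply]
    split_ifs with hz
    · rfl
    · exact (hlam z hz).symm
  have h := congrArg (fun T => T lam) (compr_mul_dirInvY hP hΔ')
  rw [Module.End.mul_apply, show dirInvY (cubeProjY i S) (deltaPrimeACubeY i q par U) lam = GpDirY i q par S U lam from rfl, h0, map_zero,
    hfix] at h
  exact h.symm

variable {N : ℕ} {G : Subgroup (Matrix (Fin N) (Fin N) ℂ)ˣ}

/-- ★★ **THE REGIME HYPOTHESIS FROM POSITIVITY** ([3] p. 25, cut to the inside blocks): if `G′(U)` is symmetric and injective on the `S`-supported fields and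
`Q′*_□(U)` is the `W`-adjoint of `Q′_□(U)`, then the compression of `Q′_□G′²Q′*_□(U)` to the block functions over `insideBlkY S` is a unit — for a block
function `ω` there, `⟨ω, Q′G′²Q′*ω⟩_W = ‖G′Q′*ω‖² = 0` forces `G′Q′*ω = 0`, `Q′*ω` is `S`-supported, so `Q′*ω = 0`, so `ω = 0`.
[cite: Balaban1984PropagatorsI, p.25; Balaban1985BackgroundPropagators, (3.25) p.394, p.409 l.1–5, Thm 3.11 p.416] -/
theorem isUnit_dirPadY_blkProjY_XCubeGY (parS : SiteParY (Matrix (Fin N) (Fin N) ℂ) i) (Gp : SiteOpY (Matrix (Fin N) (Fin N) ℂ) i) (S : Finset (SiteY i))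
    (U : CfgY (Matrix (Fin N) (Fin N) ℂ) i) (hGp : IsSymmTr (fun _ => (1 : ℝ)) (Gp U))
    (hadj : IsAdjTr (fun _ => (1 : ℝ)) (W (cubeFamY i q).toDomains) (QpCubeY i q parS U) (QpsCubeY i q parS U))
    (hG : ∀ lam : SiteY i → Matrix (Fin N) (Fin N) ℂ, (∀ z, z ∉ S → lam z = 0) → Gp U lam = 0 → lam = 0) :
    IsUnit (dirPadY (blkProjY i q (insideBlkY i q S)) (XCubeGY i q parS Gp U)) := by
  set P := blkProjY (𝔸 := Matrix (Fin N) (Fin N) ℂ) i q (insideBlkY i q S) with hPdef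
  have hP : P * P = P := blkProjY_mul_blkProjY i q _
  have hPP : ∀ v, P (P v) = P v := fun v => by rw [← Module.End.mul_apply, hP]
  refine isUnit_of_injective ((injective_iff_map_eq_zero _).mpr fun ω hω => ?_)
  have h1 : P (XCubeGY i q parS Gp U (P ω)) + (ω - P ω) = 0 := by
    simpa only [dirPadY, Module.End.mul_apply, LinearMap.add_apply, LinearMap.sub_apply, Module.End.one_apply] using hω
  have h2 : P (XCubeGY i q parS Gp U (P ω)) = 0 := by
    have h := congrArg P h1
    rwa [map_add, map_sub, hPP, hPP, sub_self, add_zero, map_zero] at h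
  have h3 : ω = P ω := by
    rw [h2, zero_add, sub_eq_zero] at h1
    exact h1
  have h4 : trIP (W (cubeFamY i q).toDomains) (XCubeGY i q parS Gp U (P ω)) (P ω) = 0 := by
    have h := blkProjY_isSymmTr i q (W (cubeFamY i q).toDomains) (insideBlkY i q S) (XCubeGY i q parS Gp U (P ω)) ω
    have hz : trIP (W (cubeFamY i q).toDomains) (0 : BlkCubeY i q → Matrix (Fin N) (Fin N) ℂ) ω = 0 := by simp [trIP]
    rw [← hPdef, h2, hz] at h
    exact h.symm
  have h5 : trIP (fun _ => (1 : ℝ)) (Gp U (QpsCubeY i q parS U (P ω))) (Gp U (QpsCubeY i q parS U (P ω))) = 0 := by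
    have e1 := hadj (Gp U (Gp U (QpsCubeY i q parS U (P ω)))) (P ω)
    have e2 := hGp (Gp U (QpsCubeY i q parS U (P ω))) (QpsCubeY i q parS U (P ω))
    have e0 : XCubeGY i q parS Gp U (P ω) = QpCubeY i q parS U (Gp U (Gp U (QpsCubeY i q parS U (P ω)))) := rfl
    rw [e0, e1, e2] at h4
    exact h4
  have h6 : Gp U (QpsCubeY i q parS U (P ω)) = 0 := by
    by_contra hne
    exact (trIP_self_pos (fun _ : SiteY i => (1 : ℝ)) (fun _ => one_pos) hne).ne' h5
  have hsupp : ∀ z, z ∉ S → QpsCubeY i q parS U (P ω) z = 0 := fun z hz => by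
    have hs : blkOf (cubeFamY i q).toDomains z ∉ insideBlkY i q S := fun hs => hz ((mem_insideBlkY_iff i q S _).1 hs z rfl)
    rw [QpsCubeY_apply_eq, hPdef, blkProjY_apply, if_neg hs, R_zero]
  have h7 : QpsCubeY i q parS U (P ω) = 0 := hG _ hsupp h6
  have h8 : P ω = 0 := qpsCubeY_injective i q parS U (by rw [h7, map_zero])
  rw [h3, h8]

/-- ★★★ **THE REGIME HYPOTHESIS OF RECORD HOLDS**: at def-Y's cube letter `parKnitCubeY i □` ((β)), the Dirichlet `G′_□` on ANY `S` and every `G`-valued background,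
`G ≤ U(N)`, `IsUnitXDirCubeY i □ S U` — by n06-d ✓`isUnit_padDeltaCubeY_parKnitCubeY` (G′_□ injective on `S`-fields), def-Y ✓`GpDirY_parKnitCubeY_isSymmTr_of_le`,
r05 ✓`isAdjTr_QpCubeY_QpsCubeY_of_mem` + def-Y ✓`parKnitCubeY_mem_unitaryUnits_of_le`.  So the `hX` of §4∕§6 is DISCHARGED at the letters of record.
[cite: Balaban1984PropagatorsI, p.25; Balaban1985BackgroundPropagators, (3.25) p.394, p.409 l.1–5, Thm 3.11 p.416] -/
theorem isUnitXDirCubeY_of_le (hGU : G ≤ unitaryUnits (Matrix (Fin N) (Fin N) ℂ)) (S : Finset (SiteY i)) {U : CfgY (Matrix (Fin N) (Fin N) ℂ) i}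
    (hU : ∀ μ x, U μ x ∈ G) : IsUnitXDirCubeY i q S U :=
  isUnit_dirPadY_blkProjY_XCubeGY i q (parKnitCubeY i q) (GpDirY i q (parKnitCubeY i q) S) S U (GpDirY_parKnitCubeY_isSymmTr_of_le i q hGU S hU)
    (isAdjTr_QpCubeY_QpsCubeY_of_mem i q le_rfl (parKnitCubeY i q) U fun z z' => parKnitCubeY_mem_unitaryUnits_of_le i q hGU hU z z')
    fun lam hlam h0 => eq_zero_of_GpDirY_apply_eq_zero i q (parKnitCubeY i q) S U (isUnit_padDeltaCubeY_parKnitCubeY i q hGU hU S) lam hlam h0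

/-- ★★ hence, at the letters of record and every `G`-valued `U`: `R_□ ∘ R_□ = R_□` … [cite: Balaban1985BackgroundPropagators, (3.25) p.394, p.409, Thm 3.11 p.416 («also for P and R»)] -/
theorem RDirCubeY_comp_RDirCubeY_of_le (hGU : G ≤ unitaryUnits (Matrix (Fin N) (Fin N) ℂ)) (S : Finset (SiteY i)) {U : CfgY (Matrix (Fin N) (Fin N) ℂ) i}
    (hU : ∀ μ x, U μ x ∈ G) : RDirCubeY i q S U ∘ₗ RDirCubeY i q S U = RDirCubeY i q S U :=
  RCubeDY_comp_RCubeDY i q (isUnitXDirCubeY_of_le i q hGU S hU)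

/-- … `P_□ ∘ P_□ = P_□` … [cite: Balaban1985BackgroundPropagators, (3.25) p.394, p.409, Thm 3.11 p.416] -/
theorem PDirCubeY_comp_PDirCubeY_of_le (hGU : G ≤ unitaryUnits (Matrix (Fin N) (Fin N) ℂ)) (S : Finset (SiteY i)) {U : CfgY (Matrix (Fin N) (Fin N) ℂ) i}
    (hU : ∀ μ x, U μ x ∈ G) : PDirCubeY i q S U ∘ₗ PDirCubeY i q S U = PDirCubeY i q S U :=
  PCubeDY_comp_PCubeDY i q (isUnitXDirCubeY_of_le i q hGU S hU)

/-- … ★ (3.20) for the sequence: `blkProjY (insideBlkY S) ∘ Q′_□ ∘ G′_□ ∘ R_□ = 0` … [cite: Balaban1985BackgroundPropagators, (3.20)–(3.21) p.394, (3.25) p.394, p.409] -/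
theorem blkProjY_QpCubeY_GpDirY_comp_RDirCubeY_of_le (hGU : G ≤ unitaryUnits (Matrix (Fin N) (Fin N) ℂ)) (S : Finset (SiteY i))
    {U : CfgY (Matrix (Fin N) (Fin N) ℂ) i} (hU : ∀ μ x, U μ x ∈ G) :
    blkProjY i q (insideBlkY i q S) ∘ₗ QpCubeY i q (parKnitCubeY i q) U ∘ₗ GpDirY i q (parKnitCubeY i q) S U ∘ₗ RDirCubeY i q S U = 0 :=
  blkProjY_QpCubeY_Gp_comp_RCubeDY i q (isUnitXDirCubeY_of_le i q hGU S hU)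

/-- … and `R_□ ∘ G′_□ ∘ Q′*_□ ∘ blkProjY (insideBlkY S) = 0`. [cite: Balaban1985BackgroundPropagators, (3.20)–(3.21) p.394, (3.25) p.394, p.409] -/
theorem RDirCubeY_comp_GpDirY_QpsCubeY_blkProjY_of_le (hGU : G ≤ unitaryUnits (Matrix (Fin N) (Fin N) ℂ)) (S : Finset (SiteY i))
    {U : CfgY (Matrix (Fin N) (Fin N) ℂ) i} (hU : ∀ μ x, U μ x ∈ G) :
    RDirCubeY i q S U ∘ₗ GpDirY i q (parKnitCubeY i q) S U ∘ₗ QpsCubeY i q (parKnitCubeY i q) U ∘ₗ blkProjY i q (insideBlkY i q S) = 0 :=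
  RCubeDY_comp_Gp_QpsCubeY_blkProjY i q (isUnitXDirCubeY_of_le i q hGU S hU)

end Pos

end Literature.MathematicalPhysics.QuantumFieldTheory.Balaban1983to89.Node00.OpsYCubeProjectionG
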